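import Mathlib
import HarnessLib
import Summits.HubbardSuperconductivity.HubbardSuperconductivity.Theorems.KLProgrammeKLRegimeSplitTwoLegSizesMSChainTableGraded

/-!
# Route `KLProgramme`, crux K3 — (E3a-MS) supplier, the term table KEYED ON FRAME SIZES (repair MS-A34-ter (K4); k3c3-p1 g4)

Seat hubbard-kl-k3c3-p1 (g4).  `…MSChainTableGraded` keys the depth-graded term table on the graded chain SUMS `chainSizeSumG` — whose low-part
entry `lowSize` (contraction / sup-Bernstein) is the one remaining d-lossy estimate (MS-A34-ter: the e-free order-4 transport entry needs the low parts'
`C⁴` total `≲ U²16^{n₀}`, which only a mixed Jackson–Bernstein bound delivers).  This file removes every size SUM from the table's hypotheses: the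
chain frames' towers are taken as FRAME-SIZE hypotheses, per chain position and DOWNWARD CLOSED,

  `hA  : ∀ k ≤ N − n, ∀ p, ∀ j ≤ 2, ‖Dʲ frameShift (msChain d Kp n N k) p‖ ≤ A`,
  `hA₃ : ∀ k ≤ N − n, ∀ k' ≤ k, ∀ p, ‖D³ frameShift (msChain d Kp n N k') p‖ ≤ A₃ k`   (and `hA₄` alike),

so that ANY estimate of the frames (the graded sums of `…MSChainGraded`, a later mixed Jackson–Bernstein low-part bound, …) plugs in by one line.
The proofs are those of `…MSChainTableGraded` run on `fermiPointLp_sizes_of_sizes` and the frame-keyed one-step estimate `step_curve_diff_of_frames`: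

* `msProfileF_centred_sizes_frames`, `abs_klAngularMean_msProfileF_le_frames` (tables `msGsFG` / `msMeanFG`, oscillation entries);
* `twoLegSizesMSWith_succ_of_chainF_table_frames` / `twoLegSizesMSWith_zero_of_chainF_table_frames` — the budget-parametric slot text at scale
  `n+1` / `0` with the COMPUTED sizes `msSizeBaseO X σ (A₃ 0) (A₄ 0)` and `msSizeSlotO X σ ε A (A₃ (m−n₀)) (A₄ (m−n₀)) Dt e n₀ m`, no fit.

Proofs only; nothing about the model.
-/

noncomputable section

namespace Summit.HubbardSuperconductivity.HubbardSuperconductivity.Theorems.KLRegimeSplit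

set_option linter.dupNamespace false -- summit = problem name (single-conjunct summit), D-0017
set_option maxSynthPendingDepth 4 -- nested operator-norm instances (symbol sizes up to order five), as in `…CompDiff`

open Real Finset Literature.MathematicalPhysics.QuantumLattice Literature.MathematicalPhysics.QuantumLattice.FermiRG
open Literature.MathematicalPhysics.QuantumLattice.BandSectorCounting
open Summit.HubbardSuperconductivity.HubbardSuperconductivity.Theorems.KLProgrammeLegKernels
open Summit.HubbardSuperconductivity.HubbardSuperconductivity.Theorems.DispersionFlow
open Summit.HubbardSuperconductivity.HubbardSuperconductivity.Theorems.PerturbedFermiCurve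

/-! ## §1 The sizes and means of all chain-family profiles, frame-keyed -/

section Table

variable (d : ℕ) (Kp : ℕ → TrigPolyC4v) (n N : ℕ)

/-- **CENTRED ANGULAR SIZES OF ALL CHAIN-FAMILY PROFILES, frame-keyed.**  As `msProfileF_centred_sizes_graded` with the chain frames' towers as
hypotheses: uniform `C²` size `A` of every frame, downward-closed order-3/4 sizes `A₃ k`, `A₄ k` per chain position. -/
theorem msProfileF_centred_sizes_frames
    {A : ℝ} (hA : ∀ k ≤ N - n, ∀ p : Momentum, ∀ j ≤ 2, ‖iteratedFDeriv ℝ j (frameShift (msChain d Kp n N k)) p‖ ≤ A) (hA20 : A ≤ 1 / 20)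
    (hd : klCurveD ≤ (bandBounds (show (-4 : ℝ) < -1.1 by norm_num) (show (-1.1 : ℝ) ≤ -0.1 by norm_num)
      (show (-0.1 : ℝ) < 0 by norm_num)).Dtmin - 2 * A)
    {μ : ℝ} (hlo : (-1.1 : ℝ) ≤ μ - A) (hhi : μ + A ≤ -0.1)
    {A₃ A₄ : ℕ → ℝ} (hA₃ : ∀ k ≤ N - n, ∀ k' ≤ k, ∀ p : Momentum, ‖iteratedFDeriv ℝ 3 (frameShift (msChain d Kp n N k')) p‖ ≤ A₃ k)
    (hA₄ : ∀ k ≤ N - n, ∀ k' ≤ k, ∀ p : Momentum, ‖iteratedFDeriv ℝ 4 (frameShift (msChain d Kp n N k')) p‖ ≤ A₄ k)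
    (S : ℕ → TrigPolyC4v) {σ : ℕ → ℕ → ℝ} (hσnn : ∀ k l, 0 ≤ σ k l) (hσ0 : ∀ k ≤ N - n, ∀ q : Momentum, |evalM (S k) q| ≤ σ k 0)
    (hσ : ∀ k ≤ N - n, ∀ l, 1 ≤ l → l ≤ 5 → ∀ q : Momentum, ‖iteratedFDeriv ℝ l (evalM (S k)) q‖ ≤ σ k l)
    {ε : ℕ → ℕ → ℝ} (hεnn : ∀ m l, 0 ≤ ε m l)
    (hε0 : ∀ m ∈ Ioc n N, ∀ q : Momentum, |evalM (fsub (S (m - n)) (S (m - n - 1))) q| ≤ ε m 0)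
    (hε : ∀ m ∈ Ioc n N, ∀ l, 1 ≤ l → l ≤ 4 → ∀ q : Momentum,
      ‖iteratedFDeriv ℝ l (evalM (fsub (S (m - n)) (S (m - n - 1)))) q‖ ≤ ε m l)
    {e : ℕ → ℕ → ℝ} (he : ∀ m ∈ Ioc n N, ∀ j ≤ 4, ∀ q : Momentum, ‖iteratedFDeriv ℝ j (evalM (highPart d (Kp m))) q‖ ≤ e m j)
    (m : ℕ) {j : ℕ} (hj : j ≤ 4) {i : ℕ} (hi : i ≤ j) (t : ℝ) :
    ‖iteratedFDeriv ℝ i (fun t => msProfileF μ S d Kp n N m t - klAngularMean (msProfileF μ S d Kp n N m)) t‖ ≤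
      msGsFG σ ε A A₃ A₄ ((bandBounds (show (-4 : ℝ) < -1.1 by norm_num) (show (-1.1 : ℝ) ≤ -0.1 by norm_num)
        (show (-0.1 : ℝ) < 0 by norm_num)).Dtmin) e n N m j := by
  set B := bandBounds (show (-4 : ℝ) < -1.1 by norm_num) (show (-1.1 : ℝ) ≤ -0.1 by norm_num) (show (-0.1 : ℝ) < 0 by norm_num)
    with hBdef
  -- the curve of frame `k' ≤ k` under the depth-`k` tower, in the `iteratedDeriv` key
  have hcurve : ∀ k ≤ N - n, ∀ k' ≤ k, ∀ θ,
      ContDiff ℝ 4 (fun θ : ℝ => (WithLp.toLp 2 (klFermiPoint μ (msChain d Kp n N k') θ) : Momentum)) ∧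
      ContDiff ℝ 4 (klFermiPoint μ (msChain d Kp n N k')) ∧
      ‖iteratedFDeriv ℝ 1 (fun θ : ℝ => (WithLp.toLp 2 (klFermiPoint μ (msChain d Kp n N k') θ) : Momentum)) θ‖ ≤ klCurveD1 ∧
      ‖iteratedFDeriv ℝ 2 (fun θ : ℝ => (WithLp.toLp 2 (klFermiPoint μ (msChain d Kp n N k') θ) : Momentum)) θ‖ ≤ klCurveD2 ∧
      ‖iteratedFDeriv ℝ 3 (fun θ : ℝ => (WithLp.toLp 2 (klFermiPoint μ (msChain d Kp n N k') θ) : Momentum)) θ‖ ≤ klCurveD3 (A₃ k) ∧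
      ‖iteratedFDeriv ℝ 4 (fun θ : ℝ => (WithLp.toLp 2 (klFermiPoint μ (msChain d Kp n N k') θ) : Momentum)) θ‖ ≤
        klCurveD4 (A₃ k) (A₄ k) :=
    fun k hk k' hk' θ => by
      obtain ⟨hC, hD1, hD2, hD3, hD4⟩ :=
        fermiPointLp_sizes_of_sizes (hA k' (hk'.trans hk)) hA20 hd hlo hhi (hA₃ k hk k' hk') (hA₄ k hk k' hk') θ
      exact ⟨hC, contDiff_of_contDiff_toLp hC, hD1, hD2, hD3, hD4⟩
  have hDk : ∀ k ≤ N - n, ∀ k' ≤ k, ∀ i, 1 ≤ i → i ≤ 4 → ∀ θ,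
      ‖iteratedDeriv i (fun θ : ℝ => (WithLp.toLp 2 (klFermiPoint μ (msChain d Kp n N k') θ) : Momentum)) θ‖ ≤ msD (A₃ k) (A₄ k) i := by
    intro k hk k' hk' i hi1 hi4 θ
    obtain ⟨-, -, d1, d2, d3, d4⟩ := hcurve k hk k' hk' θ
    rw [← norm_iteratedFDeriv_eq_norm_iteratedDeriv]
    interval_cases i
    · exact d1
    · exact d2
    · exact d3
    · exact d4
  have hCk : ∀ k ≤ N - n, ContDiff ℝ 4 (fun θ : ℝ => (WithLp.toLp 2 (klFermiPoint μ (msChain d Kp n N k) θ) : Momentum)) :=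
    fun k hk => (hcurve k hk k le_rfl 0).1
  have hCk' : ∀ k ≤ N - n, ContDiff ℝ 4 (klFermiPoint μ (msChain d Kp n N k)) :=
    fun k hk => (hcurve k hk k le_rfl 0).2.1
  have hDnn : ∀ k ≤ N - n, ∀ i, 0 ≤ msD (A₃ k) (A₄ k) i := by
    intro k hk i
    rcases i with _ | _ | _ | _ | _ | i
    · simp [msD]
    · exact (norm_nonneg _).trans (hDk k hk k le_rfl 1 le_rfl (by norm_num) 0)
    · exact (norm_nonneg _).trans (hDk k hk k le_rfl 2 (by norm_num) (by norm_num) 0)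
    · exact (norm_nonneg _).trans (hDk k hk k le_rfl 3 (by norm_num) (by norm_num) 0)
    · exact (norm_nonneg _).trans (hDk k hk k le_rfl 4 (by norm_num) (by norm_num) 0)
    · simp [msD]
  by_cases hm : m = n
  · -- the base profile
    subst hm
    rw [msProfileF_base, msGsFG, if_pos rfl]
    exact curveProfile_centred_sizes_osc μ (S 0) (msChain d Kp m N 0) (hCk 0 (by omega)) (hσnn 0) (hDnn 0 (by omega)) (hσ0 0 (by omega))
      (fun k hk1 hk4 q => hσ 0 (by omega) k hk1 (by omega) q) (hDk 0 (by omega) 0 le_rfl) hj hi t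
  by_cases hmem : m ∈ Ioc n N
  · -- a slot profile: response + transport
    set k := m - n with hkdef
    have hk1 : 1 ≤ k := by have := (Finset.mem_Ioc.mp hmem).1; omega
    have hk : k ≤ N - n := by have := (Finset.mem_Ioc.mp hmem).2; omega
    have hmk : m = n + k := by have := (Finset.mem_Ioc.mp hmem).1; omega
    have hp : msProfileF μ S d Kp n N m = fun θ =>
        curveProfile μ (fsub (S k) (S (k - 1))) (msChain d Kp n N k) θ +
          (evalM (S (k - 1)) (WithLp.toLp 2 (klFermiPoint μ (msChain d Kp n N k) θ)) -
            evalM (S (k - 1)) (WithLp.toLp 2 (klFermiPoint μ (msChain d Kp n N (k - 1)) θ))) := by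
      funext θ
      rw [msProfileF_slot μ S d Kp hmem θ, ← hkdef, curveProfile_apply μ (S (k - 1)), curveProfile_apply μ (S (k - 1))]
    rw [hp, msGsFG, if_neg hm, if_pos hmem]
    have hfc : ContDiff ℝ 4 (curveProfile μ (fsub (S k) (S (k - 1))) (msChain d Kp n N k)) :=
      contDiff_curveProfile μ _ _ (hCk' k hk)
    have hgc : ContDiff ℝ 4 (fun θ => evalM (S (k - 1)) (WithLp.toLp 2 (klFermiPoint μ (msChain d Kp n N k) θ)) -
        evalM (S (k - 1)) (WithLp.toLp 2 (klFermiPoint μ (msChain d Kp n N (k - 1)) θ))) :=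
      ((contDiff_evalM (S (k - 1))).comp (hCk k hk)).sub ((contDiff_evalM (S (k - 1))).comp (hCk (k - 1) (by omega)))
    have hi4 : i ≤ 4 := hi.trans hj
    refine (norm_iteratedFDeriv_centred_add_le (hfc.of_le (by exact_mod_cast hi4)) (hgc.of_le (by exact_mod_cast hi4))
      (hfc.continuous.intervalIntegrable _ _) (hgc.continuous.intervalIntegrable _ _) t).trans (add_le_add ?_ ?_)
    · -- response term
      exact curveProfile_centred_sizes_osc μ (fsub (S k) (S (k - 1))) (msChain d Kp n N k) (hCk k hk) (hεnn m) (hDnn k hk) (hε0 m hmem)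
        (fun l hl1 hl4 q => hε m hmem l hl1 hl4 q) (hDk k hk k le_rfl) hj hi t
    · -- transport term
      have he' : ∀ j ≤ 4, ∀ q : Momentum, ‖iteratedFDeriv ℝ j (evalM (highPart d (Kp (n + k)))) q‖ ≤ e m j := by
        rw [← hmk]; exact he m hmem
      have heq : ∀ p : Fin 2 → ℝ, (msChain d Kp n N k).eval p =
          (msChain d Kp n N (k - 1)).eval p + (highPart d (Kp (n + k))).eval p := by
        intro p
        rw [show k = (k - 1) + 1 by omega, eval_msChain_succ, show n + (k - 1) + 1 = n + (k - 1 + 1) by omega]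
        simp only [Nat.add_sub_cancel]
      have hstep := fun θ => step_curve_diff_of_frames heq (hA (k - 1) (by omega)) (hA k hk) hA20 hd hlo hhi
        (hA₃ k hk (k - 1) (Nat.sub_le k 1)) (hA₄ k hk (k - 1) (Nat.sub_le k 1)) (hA₃ k hk k le_rfl) (hA₄ k hk k le_rfl) he' θ
      have hdDnn : ∀ i, 0 ≤ msdD A (A₃ k) (A₄ k) B.Dtmin (e m) i := by
        intro i
        rcases i with _ | _ | _ | _ | _ | i
        · exact (norm_nonneg _).trans (hstep 0).1
        · exact (norm_nonneg _).trans ((hstep 0).2 1 le_rfl (by norm_num))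
        · exact (norm_nonneg _).trans ((hstep 0).2 2 (by norm_num) (by norm_num))
        · exact (norm_nonneg _).trans ((hstep 0).2 3 (by norm_num) (by norm_num))
        · exact (norm_nonneg _).trans ((hstep 0).2 4 (by norm_num) (by norm_num))
        · rw [msdD_add_five]; exact (norm_nonneg _).trans ((hstep 0).2 4 (by norm_num) (by norm_num))
      exact comp_sub_centred_sizes (F := evalM (S (k - 1))) (contDiff_evalM (S (k - 1))) (hCk (k - 1) (by omega)) (hCk k hk)
        (hσnn (k - 1)) (hDnn k hk) hdDnn (fun l hl1 hl5 q => hσ (k - 1) (by omega) l hl1 hl5 q)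
        (hDk k hk (k - 1) (Nat.sub_le k 1)) (hDk k hk k le_rfl) (fun θ => (hstep θ).1) (fun i hi1 hi4 θ => (hstep θ).2 i hi1 hi4)
        hj hi t
  · -- no profile
    rw [msProfileF_of_not_mem hm hmem, msGsFG, if_neg hm, if_neg hmem, klAngularMean_zero]
    simp

/-- **MEANS OF ALL CHAIN-FAMILY PROFILES, frame-keyed** (the `j = 0` constant entries of the fits). -/
theorem abs_klAngularMean_msProfileF_le_frames
    {A : ℝ} (hA : ∀ k ≤ N - n, ∀ p : Momentum, ∀ j ≤ 2, ‖iteratedFDeriv ℝ j (frameShift (msChain d Kp n N k)) p‖ ≤ A) (hA20 : A ≤ 1 / 20)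
    (hd : klCurveD ≤ (bandBounds (show (-4 : ℝ) < -1.1 by norm_num) (show (-1.1 : ℝ) ≤ -0.1 by norm_num)
      (show (-0.1 : ℝ) < 0 by norm_num)).Dtmin - 2 * A)
    {μ : ℝ} (hlo : (-1.1 : ℝ) ≤ μ - A) (hhi : μ + A ≤ -0.1)
    {A₃ A₄ : ℕ → ℝ} (hA₃ : ∀ k ≤ N - n, ∀ k' ≤ k, ∀ p : Momentum, ‖iteratedFDeriv ℝ 3 (frameShift (msChain d Kp n N k')) p‖ ≤ A₃ k)
    (hA₄ : ∀ k ≤ N - n, ∀ k' ≤ k, ∀ p : Momentum, ‖iteratedFDeriv ℝ 4 (frameShift (msChain d Kp n N k')) p‖ ≤ A₄ k)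
    (S : ℕ → TrigPolyC4v) {σ : ℕ → ℕ → ℝ} (hσnn : ∀ k l, 0 ≤ σ k l) (hσ0 : ∀ k ≤ N - n, ∀ q : Momentum, |evalM (S k) q| ≤ σ k 0)
    (hσ : ∀ k ≤ N - n, ∀ l, 1 ≤ l → l ≤ 5 → ∀ q : Momentum, ‖iteratedFDeriv ℝ l (evalM (S k)) q‖ ≤ σ k l)
    {ε : ℕ → ℕ → ℝ} (hε0 : ∀ m ∈ Ioc n N, ∀ q : Momentum, |evalM (fsub (S (m - n)) (S (m - n - 1))) q| ≤ ε m 0)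
    {e : ℕ → ℕ → ℝ} (he : ∀ m ∈ Ioc n N, ∀ j ≤ 4, ∀ q : Momentum, ‖iteratedFDeriv ℝ j (evalM (highPart d (Kp m))) q‖ ≤ e m j)
    (m : ℕ) :
    |klAngularMean (msProfileF μ S d Kp n N m)| ≤
      msMeanFG σ ε A A₃ A₄ ((bandBounds (show (-4 : ℝ) < -1.1 by norm_num) (show (-1.1 : ℝ) ≤ -0.1 by norm_num)
        (show (-0.1 : ℝ) < 0 by norm_num)).Dtmin) e n N m := by
  by_cases hm : m = n
  · subst hm
    rw [msMeanFG, if_pos rfl, msProfileF_base]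
    refine abs_klAngularMean_le' fun θ => ?_
    rw [curveProfile_apply]
    exact hσ0 0 (by omega) _
  by_cases hmem : m ∈ Ioc n N
  · set k := m - n with hkdef
    have hk1 : 1 ≤ k := by have := (Finset.mem_Ioc.mp hmem).1; omega
    have hk : k ≤ N - n := by have := (Finset.mem_Ioc.mp hmem).2; omega
    have hmk : m = n + k := by have := (Finset.mem_Ioc.mp hmem).1; omega
    rw [msMeanFG, if_neg hm, if_pos hmem]
    have he' : ∀ j ≤ 4, ∀ q : Momentum, ‖iteratedFDeriv ℝ j (evalM (highPart d (Kp (n + k)))) q‖ ≤ e m j := by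
      rw [← hmk]; exact he m hmem
    have heq : ∀ p : Fin 2 → ℝ, (msChain d Kp n N k).eval p =
        (msChain d Kp n N (k - 1)).eval p + (highPart d (Kp (n + k))).eval p := by
      intro p
      rw [show k = (k - 1) + 1 by omega, eval_msChain_succ, show n + (k - 1) + 1 = n + (k - 1 + 1) by omega]
      simp only [Nat.add_sub_cancel]
    have hstep := fun θ => step_curve_diff_of_frames heq (hA (k - 1) (by omega)) (hA k hk) hA20 hd hlo hhi
      (hA₃ k hk (k - 1) (Nat.sub_le k 1)) (hA₄ k hk (k - 1) (Nat.sub_le k 1)) (hA₃ k hk k le_rfl) (hA₄ k hk k le_rfl) he' θ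
    have hM₁ : ∀ z : Momentum, ‖fderiv ℝ (evalM (S (k - 1))) z‖ ≤ σ (k - 1) 1 := fun z => by
      rw [norm_fderiv_eq_norm_iteratedFDeriv_one]; exact hσ (k - 1) (by omega) 1 le_rfl (by norm_num) z
    refine abs_klAngularMean_le' fun θ => ?_
    rw [msProfileF_slot μ S d Kp hmem θ]
    refine (abs_add_le _ _).trans (add_le_add ?_ ?_)
    · rw [curveProfile_apply]; exact hε0 m hmem _
    · rw [curveProfile_apply, curveProfile_apply]
      have h := (convex_univ).norm_image_sub_le_of_norm_fderiv_le (𝕜 := ℝ) (f := evalM (S (k - 1)))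
        (fun z _ => ((contDiff_evalM (S (k - 1)) (k := 1)).differentiable one_ne_zero) z) (fun z _ => hM₁ z)
        (Set.mem_univ (WithLp.toLp 2 (klFermiPoint μ (msChain d Kp n N (k - 1)) θ) : Momentum))
        (Set.mem_univ (WithLp.toLp 2 (klFermiPoint μ (msChain d Kp n N k) θ) : Momentum))
      rw [Real.norm_eq_abs] at h
      exact h.trans (mul_le_mul_of_nonneg_left (hstep θ).1 (hσnn (k - 1) 1))
  · rw [msProfileF_of_not_mem hm hmem, msMeanFG, if_neg hm, if_neg hmem, klAngularMean_zero, abs_zero]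

end Table

/-! ## §2 The budget-parametric slot text from the frame-keyed table -/

section MS

variable {L M : ℕ} [NeZero L] [NeZero M] {β U μ : ℝ}

/-- **(E3a-MS), parametric, AT SCALE `n+1` FROM THE DEPTH-GRADED TERM TABLE** (sizes `msSizeBaseO X σ (A₃ 0) (A₄ 0)` and
`msSizeSlotO X σ ε A (A₃ (m−n₀)) (A₄ (m−n₀)) Dt e n₀ m`, no fit).  Binders as in `twoLegSizesMST_succ_of_chainF_table` (`…MSOfTableF`) minus the fits,
with the chain regime given by FRAME SIZES per chain position (`A₃ A₄ : ℕ → ℝ`, downward closed). -/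
theorem twoLegSizesMSWith_succ_of_chainF_table_frames (hμ : μ ∈ klWindowC) {K : TrigPolyC4v} {Kp : ℕ → TrigPolyC4v}
    (hK : ∀ p : Fin 2 → ℝ, K.eval p = ∑ m ∈ range (nScales β + 1), (Kp m).eval p) {n : ℕ} (hn : n + 1 ≤ nScales β) (d : ℕ)
    (hc₁ : Continuous (klLocalPart L M β U μ K (n + 1))) (hc₀ : Continuous (klLocalPart L M β U μ K n))
    {S : ℕ → TrigPolyC4v}
    (hS : ∀ θ, klLocalPart L M β U μ K (n + 1) θ - klLocalPart L M β U μ K n θ =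
      (S (nScales β - (n + 1))).eval (klFermiPoint μ K θ))
    {A : ℝ} (hA : ∀ k ≤ nScales β - (n + 1), ∀ p : Momentum, ∀ j ≤ 2,
      ‖iteratedFDeriv ℝ j (frameShift (msChain d Kp (n + 1) (nScales β) k)) p‖ ≤ A) (hA20 : A ≤ 1 / 20)
    (hd : klCurveD ≤ (bandBounds (show (-4 : ℝ) < -1.1 by norm_num) (show (-1.1 : ℝ) ≤ -0.1 by norm_num)
      (show (-0.1 : ℝ) < 0 by norm_num)).Dtmin - 2 * A)
    (hlo : (-1.1 : ℝ) ≤ μ - A) (hhi : μ + A ≤ -0.1)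
    {A₃ A₄ : ℕ → ℝ}
    (hA₃ : ∀ k ≤ nScales β - (n + 1), ∀ k' ≤ k, ∀ p : Momentum, ‖iteratedFDeriv ℝ 3 (frameShift (msChain d Kp (n + 1) (nScales β) k')) p‖ ≤ A₃ k)
    (hA₄ : ∀ k ≤ nScales β - (n + 1), ∀ k' ≤ k, ∀ p : Momentum, ‖iteratedFDeriv ℝ 4 (frameShift (msChain d Kp (n + 1) (nScales β) k')) p‖ ≤ A₄ k)
    {σ : ℕ → ℕ → ℝ} (hσnn : ∀ k l, 0 ≤ σ k l)
    (hσ0 : ∀ k ≤ nScales β - (n + 1), ∀ q : Momentum, |evalM (S k) q| ≤ σ k 0)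
    (hσ : ∀ k ≤ nScales β - (n + 1), ∀ l, 1 ≤ l → l ≤ 5 → ∀ q : Momentum, ‖iteratedFDeriv ℝ l (evalM (S k)) q‖ ≤ σ k l)
    {ε : ℕ → ℕ → ℝ} (hεnn : ∀ m l, 0 ≤ ε m l)
    (hε0 : ∀ m ∈ Ioc (n + 1) (nScales β), ∀ q : Momentum, |evalM (fsub (S (m - (n + 1))) (S (m - (n + 1) - 1))) q| ≤ ε m 0)
    (hε : ∀ m ∈ Ioc (n + 1) (nScales β), ∀ l, 1 ≤ l → l ≤ 4 → ∀ q : Momentum,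
      ‖iteratedFDeriv ℝ l (evalM (fsub (S (m - (n + 1))) (S (m - (n + 1) - 1)))) q‖ ≤ ε m l)
    {e : ℕ → ℕ → ℝ}
    (he : ∀ m ∈ Ioc (n + 1) (nScales β), ∀ j ≤ 4, ∀ q : Momentum, ‖iteratedFDeriv ℝ j (evalM (highPart d (Kp m))) q‖ ≤ e m j)
    {X : ℝ} (hX : ∀ l ≤ 4, ∀ x : ℝ, ‖iteratedFDeriv ℝ l salmhoferCutoff x‖ ≤ X) :
    TwoLegSizesMSWith L M β U μ K.eval (n + 1) (msSizeBaseO X σ (A₃ 0) (A₄ 0))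
      (fun m j => msSizeSlotO X σ ε A (A₃ (m - (n + 1))) (A₄ (m - (n + 1))) ((bandBounds (show (-4 : ℝ) < -1.1 by norm_num)
        (show (-1.1 : ℝ) ≤ -0.1 by norm_num) (show (-0.1 : ℝ) < 0 by norm_num)).Dtmin) e (n + 1) m j) := by
  set B := bandBounds (show (-4 : ℝ) < -1.1 by norm_num) (show (-1.1 : ℝ) ≤ -0.1 by norm_num) (show (-0.1 : ℝ) < 0 by norm_num)
    with hBdef
  have hX0 : 0 ≤ X := cutoffNumeral_nonneg hX
  have hC : ∀ k ≤ nScales β - (n + 1), ContDiff ℝ 4 (klFermiPoint μ (msChain d Kp (n + 1) (nScales β) k)) :=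
    fun k hk => contDiff_of_contDiff_toLp
      (fermiPointLp_sizes_of_sizes (hA k hk) hA20 hd hlo hhi (hA₃ k hk k le_rfl) (hA₄ k hk k le_rfl) 0).1
  have hGs := fun m j (hj : j ≤ 4) i (hi : i ≤ j) t =>
    msProfileF_centred_sizes_frames d Kp (n + 1) (nScales β) hA hA20 hd hlo hhi hA₃ hA₄ S hσnn hσ0 hσ hεnn hε0 hε he m hj hi t
  have hmean := abs_klAngularMean_msProfileF_le_frames d Kp (n + 1) (nScales β) hA hA20 hd hlo hhi hA₃ hA₄ S hσnn hσ0 hσ hε0 he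
  refine (twoLegSizesMSWith_succ_of_chainF_sizes hμ hK hn d hc₁ hc₀ hS hC hX
    (fun m j => msGsFG σ ε A A₃ A₄ B.Dtmin e (n + 1) (nScales β) m j) hGs).mono ?_ ?_
  · intro j _
    have h1 : |klAngularMean (msProfileF μ S d Kp (n + 1) (nScales β) (n + 1))| ≤ σ 0 0 := by
      simpa [msMeanFG] using hmean (n + 1)
    have h2 : msGsFG σ ε A A₃ A₄ B.Dtmin e (n + 1) (nScales β) (n + 1) j = bellCumOsc (σ 0) (msD (A₃ 0) (A₄ 0)) j := by simp [msGsFG]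
    exact extSize_mono hX0 h1 h2.le j
  · intro m hm j _
    have hne : m ≠ n + 1 := by have := (Finset.mem_Ioc.mp hm).1; omega
    have h1 : |klAngularMean (msProfileF μ S d Kp (n + 1) (nScales β) m)| ≤
        ε m 0 + σ (m - (n + 1) - 1) 1 * msdD A (A₃ (m - (n + 1))) (A₄ (m - (n + 1))) B.Dtmin (e m) 0 := by
      simpa [msMeanFG, hne, hm] using hmean m
    have h2 : msGsFG σ ε A A₃ A₄ B.Dtmin e (n + 1) (nScales β) m j =
        bellCumOsc (ε m) (msD (A₃ (m - (n + 1))) (A₄ (m - (n + 1)))) j +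
          bellDiffCum (σ (m - (n + 1) - 1)) (msD (A₃ (m - (n + 1))) (A₄ (m - (n + 1))))
            (msdD A (A₃ (m - (n + 1))) (A₄ (m - (n + 1))) B.Dtmin (e m)) j := by
      simp [msGsFG, hne, hm]
    exact extSize_mono hX0 h1 h2.le j

/-- **(E3a-MS), parametric, AT SCALE `0` FROM THE DEPTH-GRADED TERM TABLE** (sizes `msSizeBaseO X σ (A₃ 0) (A₄ 0)` and
`msSizeSlotO X σ ε A (A₃ m) (A₄ m) Dt e 0 m`, no fit). -/
theorem twoLegSizesMSWith_zero_of_chainF_table_frames (hμ : μ ∈ klWindowC) {K : TrigPolyC4v} {Kp : ℕ → TrigPolyC4v}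
    (hK : ∀ p : Fin 2 → ℝ, K.eval p = ∑ m ∈ range (nScales β + 1), (Kp m).eval p) (d : ℕ)
    (hc₀ : Continuous (klLocalPart L M β U μ K 0))
    {S : ℕ → TrigPolyC4v}
    (hS : ∀ θ, klLocalPart L M β U μ K 0 θ - K.eval (klFermiPoint μ K θ) = (S (nScales β)).eval (klFermiPoint μ K θ))
    {A : ℝ} (hA : ∀ k ≤ nScales β - 0, ∀ p : Momentum, ∀ j ≤ 2,
      ‖iteratedFDeriv ℝ j (frameShift (msChain d Kp 0 (nScales β) k)) p‖ ≤ A) (hA20 : A ≤ 1 / 20)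
    (hd : klCurveD ≤ (bandBounds (show (-4 : ℝ) < -1.1 by norm_num) (show (-1.1 : ℝ) ≤ -0.1 by norm_num)
      (show (-0.1 : ℝ) < 0 by norm_num)).Dtmin - 2 * A)
    (hlo : (-1.1 : ℝ) ≤ μ - A) (hhi : μ + A ≤ -0.1)
    {A₃ A₄ : ℕ → ℝ}
    (hA₃ : ∀ k ≤ nScales β - 0, ∀ k' ≤ k, ∀ p : Momentum, ‖iteratedFDeriv ℝ 3 (frameShift (msChain d Kp 0 (nScales β) k')) p‖ ≤ A₃ k)
    (hA₄ : ∀ k ≤ nScales β - 0, ∀ k' ≤ k, ∀ p : Momentum, ‖iteratedFDeriv ℝ 4 (frameShift (msChain d Kp 0 (nScales β) k')) p‖ ≤ A₄ k)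
    {σ : ℕ → ℕ → ℝ} (hσnn : ∀ k l, 0 ≤ σ k l)
    (hσ0 : ∀ k ≤ nScales β, ∀ q : Momentum, |evalM (S k) q| ≤ σ k 0)
    (hσ : ∀ k ≤ nScales β, ∀ l, 1 ≤ l → l ≤ 5 → ∀ q : Momentum, ‖iteratedFDeriv ℝ l (evalM (S k)) q‖ ≤ σ k l)
    {ε : ℕ → ℕ → ℝ} (hεnn : ∀ m l, 0 ≤ ε m l)
    (hε0 : ∀ m ∈ Ioc 0 (nScales β), ∀ q : Momentum, |evalM (fsub (S m) (S (m - 1))) q| ≤ ε m 0)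
    (hε : ∀ m ∈ Ioc 0 (nScales β), ∀ l, 1 ≤ l → l ≤ 4 → ∀ q : Momentum,
      ‖iteratedFDeriv ℝ l (evalM (fsub (S m) (S (m - 1)))) q‖ ≤ ε m l)
    {e : ℕ → ℕ → ℝ}
    (he : ∀ m ∈ Ioc 0 (nScales β), ∀ j ≤ 4, ∀ q : Momentum, ‖iteratedFDeriv ℝ j (evalM (highPart d (Kp m))) q‖ ≤ e m j)
    {X : ℝ} (hX : ∀ l ≤ 4, ∀ x : ℝ, ‖iteratedFDeriv ℝ l salmhoferCutoff x‖ ≤ X) :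
    TwoLegSizesMSWith L M β U μ K.eval 0 (msSizeBaseO X σ (A₃ 0) (A₄ 0))
      (fun m j => msSizeSlotO X σ ε A (A₃ (m - 0)) (A₄ (m - 0)) ((bandBounds (show (-4 : ℝ) < -1.1 by norm_num)
        (show (-1.1 : ℝ) ≤ -0.1 by norm_num) (show (-0.1 : ℝ) < 0 by norm_num)).Dtmin) e 0 m j) := by
  set B := bandBounds (show (-4 : ℝ) < -1.1 by norm_num) (show (-1.1 : ℝ) ≤ -0.1 by norm_num) (show (-0.1 : ℝ) < 0 by norm_num)
    with hBdef
  have hX0 : 0 ≤ X := cutoffNumeral_nonneg hX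
  have hC : ∀ k ≤ nScales β, ContDiff ℝ 4 (klFermiPoint μ (msChain d Kp 0 (nScales β) k)) :=
    fun k hk => contDiff_of_contDiff_toLp
      (fermiPointLp_sizes_of_sizes (hA k (by omega)) hA20 hd hlo hhi (hA₃ k (by omega) k le_rfl) (hA₄ k (by omega) k le_rfl) 0).1
  have hσ0' : ∀ k ≤ nScales β - 0, ∀ q : Momentum, |evalM (S k) q| ≤ σ k 0 := fun k hk => hσ0 k (by omega)
  have hσ' : ∀ k ≤ nScales β - 0, ∀ l, 1 ≤ l → l ≤ 5 → ∀ q : Momentum, ‖iteratedFDeriv ℝ l (evalM (S k)) q‖ ≤ σ k l :=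
    fun k hk => hσ k (by omega)
  have hε0' : ∀ m ∈ Ioc 0 (nScales β), ∀ q : Momentum, |evalM (fsub (S (m - 0)) (S (m - 0 - 1))) q| ≤ ε m 0 := by
    simpa only [Nat.sub_zero] using hε0
  have hε' : ∀ m ∈ Ioc 0 (nScales β), ∀ l, 1 ≤ l → l ≤ 4 → ∀ q : Momentum,
      ‖iteratedFDeriv ℝ l (evalM (fsub (S (m - 0)) (S (m - 0 - 1)))) q‖ ≤ ε m l := by
    simpa only [Nat.sub_zero] using hε
  have hGs := fun m j (hj : j ≤ 4) i (hi : i ≤ j) t =>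
    msProfileF_centred_sizes_frames d Kp 0 (nScales β) hA hA20 hd hlo hhi hA₃ hA₄ S hσnn hσ0' hσ' hεnn hε0' hε' he m hj hi t
  have hmean := abs_klAngularMean_msProfileF_le_frames d Kp 0 (nScales β) hA hA20 hd hlo hhi hA₃ hA₄ S hσnn hσ0' hσ' hε0' he
  refine (twoLegSizesMSWith_zero_of_chainF_sizes hμ hK d hc₀ hS hC hX
    (fun m j => msGsFG σ ε A A₃ A₄ B.Dtmin e 0 (nScales β) m j) hGs).mono ?_ ?_
  · intro j _
    have h1 : |klAngularMean (msProfileF μ S d Kp 0 (nScales β) 0)| ≤ σ 0 0 := by simpa [msMeanFG] using hmean 0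
    have h2 : msGsFG σ ε A A₃ A₄ B.Dtmin e 0 (nScales β) 0 j = bellCumOsc (σ 0) (msD (A₃ 0) (A₄ 0)) j := by simp [msGsFG]
    exact extSize_mono hX0 h1 h2.le j
  · intro m hm j _
    have hne : m ≠ 0 := by have := (Finset.mem_Ioc.mp hm).1; omega
    have h1 : |klAngularMean (msProfileF μ S d Kp 0 (nScales β) m)| ≤
        ε m 0 + σ (m - 0 - 1) 1 * msdD A (A₃ (m - 0)) (A₄ (m - 0)) B.Dtmin (e m) 0 := by
      simpa [msMeanFG, hne, hm] using hmean m
    have h2 : msGsFG σ ε A A₃ A₄ B.Dtmin e 0 (nScales β) m j =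
        bellCumOsc (ε m) (msD (A₃ (m - 0)) (A₄ (m - 0))) j +
          bellDiffCum (σ (m - 0 - 1)) (msD (A₃ (m - 0)) (A₄ (m - 0))) (msdD A (A₃ (m - 0)) (A₄ (m - 0)) B.Dtmin (e m)) j := by
      simp [msGsFG, hne, hm]
    exact extSize_mono hX0 h1 h2.le j


end MS

end Summit.HubbardSuperconductivity.HubbardSuperconductivity.Theorems.KLRegimeSplit

end
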